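import Summits.CriticalPhenomena.PercolationContinuityZ3.Theorems.PercNearOneGluingNoHeavyConstsChainRuleBernsteinCexTable
import HarnessLib

/-!
# REFUTATION of the conjecture `Consts.ChainRuleBernstein` (BERN), file 2 of 2: reindexing and `¬ Consts.ChainRuleBernstein`

Support file (`--supports stmt-CriticalPhenomena-4575`), lead seat `prim-nh-lead-4575` (gen 100); builds on p205010 (kernel theorem,
internal audit signed; external expert review pending).  No named facts, no definitions, no sorries; standard axioms.

With the data of file 1 (`…ConstsChainRuleBernsteinCexTable.lean`: witness `BernCex.D`, separation bits `sepB`, kernel-checked level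
table `table_spec`, signed count `BernCex.sum_tm : Σ_p tm p = −1`, index maps `Φ / Ψ`, profile `kW`) this file proves, IN THE KERNEL:
* REINDEXING: the triples `η : Fin 3 → BondConfig (Fin 7)` with profile `kW` (every pair open in exactly `kW e` of the three copies)
  are exactly the `Φ p`, `p : P9` (`profile_Φ`, `Φ_Ψ`, `Ψ_Φ`; for ANY decidability instances, as they come from the conjecture);
* ENTRIES: `S_r ↮ T_c` in copy `c` of `Φ p` is the separation bit `sepB (tOf p c) r c` (`sepB_iff`, via `FK.RCEval.reachB_iff`), so the
  `0/1` determinant is `det3` of the bits, `= tm p` by monotone columns and the table (`det3_Φ`);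
* `fibre_sum_det`: the conjecture's fibre sum at the witness equals `Σ_p tm p = −1`, whence **`Consts.not_chainRuleBernstein`**.
The chain rule `Consts.SingleEdgeChainRule` is NOT refuted (at the witness `Δ > 0`); only the coefficientwise conjecture falls, and with
it the route BERN ⟹ chain rule (`Consts.singleEdgeChainRule_of_chainRuleBernstein` now has a false hypothesis).
[cite: VandenbergHaggstromKahn2005, Thm. 1.1 (pp. 3–5)] [cite: Grimmett1999, §1.3 p. 10]
-/

namespace Summit.CriticalPhenomena.PercolationContinuityZ3.Theorems

namespace Consts

namespace BernCex

open Literature.Probability.LatticeModels Literature.Probability.Percolation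

noncomputable section

open scoped Classical

/-- A listed pair is open in copy `c` of `Φ p` iff the selector says so. [folklore] -/
theorem edge_mem_Φ (p : P9) (c : Fin 3) (i : Fin 9) : D.edge i ∈ Φ p c ↔ sel i (comp p i) c = true := by
  unfold Φ
  rw [FK.RCEval.edge_mem_conf D_valid, mem_tOf]

/-- Unlisted pairs are closed in every copy of `Φ p`. [folklore] -/
theorem not_mem_Φ (p : P9) (c : Fin 3) {e : Sym2 (Fin 7)} (he : e ∉ Set.range D.edge) : e ∉ Φ p c :=
  fun h => he (FK.RCEval.conf_subset_range _ h)

/-- The profile of a listed pair. [folklore] -/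
theorem kW_edge (i : Fin 9) : kW (D.edge i) = if two i then 2 else 1 := by
  unfold kW
  rw [Finset.sum_eq_single i (fun j _ hji => if_neg fun h => hji (D_valid.1 h))
    (fun h => absurd (Finset.mem_univ i) h), if_pos rfl]

/-- The profile vanishes off the listed pairs. [folklore] -/
theorem kW_notMem {e : Sym2 (Fin 7)} (he : e ∉ Set.range D.edge) : kW e = 0 :=
  Finset.sum_eq_zero fun i _ => if_neg fun h => he ⟨i, h⟩

/-- One choice opens the pair `e_i` in exactly `k(e_i)` copies. [folklore] -/
theorem sum_sel : ∀ (i : Fin 9) (j : Fin 3), (∑ c : Fin 3, if sel i j c = true then (1 : ℕ) else 0) = if two i then 2 else 1 := by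
  decide

/-- **`Φ p` has profile `k`** (for any decidability of membership, as in the conjecture's filter). [folklore] -/
theorem profile_Φ (p : P9) {I : ∀ (c : Fin 3) (e : Sym2 (Fin 7)), Decidable (e ∈ Φ p c)} :
    (fun e => ∑ c : Fin 3, @ite ℕ (e ∈ Φ p c) (I c e) 1 0) = kW := by
  funext e
  by_cases he : e ∈ Set.range D.edge
  · obtain ⟨i, rfl⟩ := he
    rw [kW_edge, ← sum_sel i (comp p i)]
    exact Finset.sum_congr rfl fun c _ => if_congr (edge_mem_Φ p c i) rfl rfl
  · rw [kW_notMem he]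
    exact Finset.sum_eq_zero fun c _ => if_neg (not_mem_Φ p c he)

/-- A `Prop`-indicator is the indicator of its `decide` (any two decidability instances). [folklore] -/
theorem ite_eq_decide (P : Prop) {I : Decidable P} {J : Decidable P} :
    @ite ℕ P I 1 0 = if @decide P J = true then 1 else 0 := by
  by_cases hP : P
  · rw [if_pos hP, if_pos ((@decide_eq_true_iff P J).2 hP)]
  · rw [if_neg hP, if_neg (mt (@decide_eq_true_iff P J).1 hP)]

/-- Three bits with exactly one `true`: bit `c` is set iff `c` is the first set bit. [folklore] -/
theorem fin3_one (d : Fin 3 → Bool)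
    (h : (∑ c : Fin 3, if d c = true then (1 : ℕ) else 0) = 1) (c : Fin 3) :
    d c = true ↔ (if d 0 = true then (0 : Fin 3) else if d 1 = true then 1 else 2) = c := by
  have key : ∀ d0 d1 d2 : Bool,
      (if d0 = true then (1 : ℕ) else 0) + (if d1 = true then 1 else 0) + (if d2 = true then 1 else 0) = 1 →
        ∀ c : Fin 3, (![d0, d1, d2] c = true ↔ (if d0 = true then (0 : Fin 3) else if d1 = true then 1 else 2) = c) := by
    decide
  have hc : ![d 0, d 1, d 2] c = d c := by fin_cases c <;> rfl
  rw [← hc]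
  exact key (d 0) (d 1) (d 2) (by rwa [Fin.sum_univ_three] at h) c

/-- Three bits with exactly two `true`: bit `c` is set iff `c` is not the first unset bit. [folklore] -/
theorem fin3_two (d : Fin 3 → Bool)
    (h : (∑ c : Fin 3, if d c = true then (1 : ℕ) else 0) = 2) (c : Fin 3) :
    d c = true ↔ (if d 0 = false then (0 : Fin 3) else if d 1 = false then 1 else 2) ≠ c := by
  have key : ∀ d0 d1 d2 : Bool,
      (if d0 = true then (1 : ℕ) else 0) + (if d1 = true then 1 else 0) + (if d2 = true then 1 else 0) = 2 →
        ∀ c : Fin 3, (![d0, d1, d2] c = true ↔ (if d0 = false then (0 : Fin 3) else if d1 = false then 1 else 2) ≠ c) := by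
    decide
  have hc : ![d 0, d 1, d 2] c = d c := by fin_cases c <;> rfl
  rw [← hc]
  exact key (d 0) (d 1) (d 2) (by rwa [Fin.sum_univ_three] at h) c

/-- **Surjectivity**: a triple with profile `k` is `Φ` of its index. [folklore] -/
theorem Φ_Ψ (η : Fin 3 → BondConfig (Fin 7)) {I : ∀ (c : Fin 3) (e : Sym2 (Fin 7)), Decidable (e ∈ η c)}
    (hη : (fun e => ∑ c : Fin 3, @ite ℕ (e ∈ η c) (I c e) 1 0) = kW) : Φ (Ψ η) = η := by
  funext c; ext e
  by_cases he : e ∈ Set.range D.edge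
  · obtain ⟨i, rfl⟩ := he
    rw [edge_mem_Φ, comp_Ψ]
    have hcount : (∑ c : Fin 3, if @decide (D.edge i ∈ η c) (Classical.propDecidable _) = true then (1 : ℕ) else 0) =
        if two i then 2 else 1 := by
      rw [← kW_edge i, ← congrFun hη (D.edge i)]
      exact Finset.sum_congr rfl fun c _ => (ite_eq_decide _).symm
    unfold sel Ψc
    cases ht : two i
    · simp only [ht, Bool.false_eq_true, ↓reduceIte] at hcount ⊢
      rw [decide_eq_true_iff]
      have key := fin3_one (fun c => @decide (D.edge i ∈ η c) (Classical.propDecidable _)) hcount c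
      exact key.symm.trans (@decide_eq_true_iff _ (Classical.propDecidable _))
    · simp only [ht, ↓reduceIte] at hcount ⊢
      rw [decide_eq_true_iff]
      have key := fin3_two (fun c => @decide (D.edge i ∈ η c) (Classical.propDecidable _)) hcount c
      exact key.symm.trans (@decide_eq_true_iff _ (Classical.propDecidable _))
  · have h0 : (∑ c : Fin 3, @ite ℕ (e ∈ η c) (I c e) 1 0) = 0 := by
      have h0' := congrFun hη e
      rw [kW_notMem he] at h0'
      exact h0'
    have hc : e ∉ η c := fun h => by
      have := Finset.sum_eq_zero_iff.1 h0 c (Finset.mem_univ c)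
      rw [if_pos h] at this
      exact one_ne_zero this
    exact ⟨fun h => absurd h (not_mem_Φ _ c he), fun h => absurd h hc⟩

/-- The inverse map recovers the components of an index. [folklore] -/
theorem Ψc_Φ (p : P9) (i : Fin 9) : Ψc (Φ p) i = comp p i := by
  have hd : ∀ c, decide (D.edge i ∈ Φ p c) = sel i (comp p i) c := fun c =>
    Bool.eq_iff_iff.2 (decide_eq_true_iff.trans (edge_mem_Φ p c i))
  unfold Ψc
  rw [hd 0, hd 1]
  unfold sel
  generalize comp p i = j
  revert j
  fin_cases i <;> decide

/-- **Injectivity**: `Ψ ∘ Φ = id`. [folklore] -/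
theorem Ψ_Φ (p : P9) : Ψ (Φ p) = p := by
  obtain ⟨p0, p1, p2, p3, p4, p5, p6, p7, p8⟩ := p
  simp only [Ψ, Ψc_Φ]
  rfl

/-- **The matrix entries**: `S_r ↮ T_c` in the configuration of open listed pairs `t` is the separation bit `sepB t r c`
(`FK.RCEval.reachB_iff`). [folklore] -/
theorem sepB_iff (t : Finset (Fin 9)) (r c : Fin 3) :
    (∀ s ∈ (![({6} : Set (Fin 7)), {6, 4}, {6, 4, 3}] r), ∀ t' ∈ (![insert 3 ({1} : Set (Fin 7)), {1}, insert 2 {1}] c),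
        ¬ (openGraph (D.conf t)).Reachable s t') ↔ sepB t r c = true := by
  have hR : ∀ s t' : Fin 7, (¬ (openGraph (D.conf t)).Reachable s t') ↔ (! D.reachB t s t') = true := by
    intro s t'
    rw [← FK.RCEval.reachB_iff]
    cases D.reachB t s t' <;> simp
  unfold sepB
  fin_cases r <;> fin_cases c <;> simp [SL, TL, hR]

/-- Determinant of a `0/1` matrix given by bits, over `ℝ`. [folklore] -/
theorem det_bits (b : Fin 3 → Fin 3 → Bool) :
    (Matrix.of fun r c : Fin 3 => if b r c = true then (1 : ℝ) else 0).det = (det3 b : ℝ) := by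
  rw [Matrix.det_fin_three]
  simp only [Matrix.of_apply, det3, iv]
  push_cast
  ring

/-- Determinant of a `Prop`-indicator matrix whose entries are decided by bits (any decidability instances). [folklore] -/
theorem det_entry_congr {P : Fin 3 → Fin 3 → Prop} (I : ∀ r c, Decidable (P r c)) (b : Fin 3 → Fin 3 → Bool)
    (h : ∀ r c, P r c ↔ b r c = true) :
    (Matrix.of fun r c : Fin 3 => @ite ℝ (P r c) (I r c) 1 0).det = (det3 b : ℝ) := by
  have hM : (Matrix.of fun r c : Fin 3 => @ite ℝ (P r c) (I r c) 1 0) =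
      Matrix.of fun r c : Fin 3 => if b r c = true then (1 : ℝ) else 0 := by
    ext r c
    exact if_congr (h r c) rfl rfl
  rw [hM, det_bits]

/-- **The signed term at an index is the determinant of its separation bits** (monotone columns and levels from the table).
[folklore] -/
theorem det3_Φ (p : P9) : det3 (fun r c => sepB (tOf p c) r c) = tm p := by
  obtain ⟨h00, h01, h02⟩ := table_spec (tOf p 0) 0
  obtain ⟨h10, h11, h12⟩ := table_spec (tOf p 1) 1
  obtain ⟨h20, h21, h22⟩ := table_spec (tOf p 2) 2
  have key := det3_eq_sg (fun r c => sepB (tOf p c) r c) ⟨h00, h01⟩ ⟨h10, h11⟩ ⟨h20, h21⟩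
  simp only [lv] at key h02 h12 h22
  rw [key, h02, h12, h22]
  rfl

/-- The matrix entries at an index: `S_r ↮ T_c` in copy `c` of `Φ q` is the separation bit. [folklore] -/
theorem sepB_iff_Φ (q : P9) (r c : Fin 3) :
    (∀ s ∈ (![({6} : Set (Fin 7)), {6, 4}, {6, 4, 3}] r), ∀ t' ∈ (![insert 3 ({1} : Set (Fin 7)), {1}, insert 2 {1}] c),
        ¬ (openGraph (Φ q c)).Reachable s t') ↔ sepB (tOf q c) r c = true := by
  unfold Φ
  exact sepB_iff (tOf q c) r c

/-- **The fibre sum, reindexed and evaluated**: over the triples of configurations with profile `k`, the sum of the determinants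
`det[1{S_r ↮ T_c in copy c}]` equals the kernel-evaluated signed count `Σ_p tm p` (all decidability / finiteness instances are
arbitrary, as they come from the conjecture's statement). [folklore] -/
theorem fibre_sum_det {FT : Fintype (Fin 3 → BondConfig (Fin 7))}
    {I : ∀ (η : Fin 3 → BondConfig (Fin 7)) (c : Fin 3) (e : Sym2 (Fin 7)), Decidable (e ∈ η c)}
    {J : DecidablePred fun η : Fin 3 → BondConfig (Fin 7) => (fun e => ∑ c : Fin 3, @ite ℕ (e ∈ η c) (I η c e) 1 0) = kW}
    {K : ∀ (η : Fin 3 → BondConfig (Fin 7)) (r c : Fin 3),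
      Decidable (∀ s ∈ (![({6} : Set (Fin 7)), {6, 4}, {6, 4, 3}] r), ∀ t ∈ (![insert 3 ({1} : Set (Fin 7)), {1}, insert 2 {1}] c),
        ¬ (openGraph (η c)).Reachable s t)} :
    (∑ η ∈ @Finset.filter _ (fun η : Fin 3 → BondConfig (Fin 7) => (fun e => ∑ c : Fin 3, @ite ℕ (e ∈ η c) (I η c e) 1 0) = kW)
        J (@Finset.univ _ FT),
      (Matrix.of fun r c : Fin 3 =>
        @ite ℝ (∀ s ∈ (![({6} : Set (Fin 7)), {6, 4}, {6, 4, 3}] r), ∀ t ∈ (![insert 3 ({1} : Set (Fin 7)), {1}, insert 2 {1}] c),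
          ¬ (openGraph (η c)).Reachable s t) (K η r c) 1 0).det) = ((∑ p : P9, tm p : ℤ) : ℝ) := by
  rw [Finset.sum_nbij' Ψ Φ (t := (Finset.univ : Finset P9)) (g := fun p => ((tm p : ℤ) : ℝ)) ?hi ?hj ?hl ?hr ?hh]
  · push_cast
    rfl
  case hi => exact fun η _ => Finset.mem_univ _
  case hj => exact fun p _ => (@Finset.mem_filter _ _ J _ _).2 ⟨@Finset.mem_univ _ FT _, profile_Φ p⟩
  case hl => exact fun η hη => Φ_Ψ η ((@Finset.mem_filter _ _ J _ _).1 hη).2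
  case hr => exact fun p _ => Ψ_Φ p
  case hh =>
    intro η hη
    have e : Φ (Ψ η) = η := Φ_Ψ η ((@Finset.mem_filter _ _ J _ _).1 hη).2
    have hc : ∀ c, η c = Φ (Ψ η) c := fun c => (congrFun e c).symm
    show _ = ((tm (Ψ η) : ℤ) : ℝ)
    rw [← det3_Φ (Ψ η)]
    refine det_entry_congr (K η) (fun r c => sepB (tOf (Ψ η) c) r c) fun r c => ?_
    rw [hc c]
    exact sepB_iff_Φ (Ψ η) r c

end

end BernCex

/-- **REFUTATION of `Consts.ChainRuleBernstein`.**  The Bernstein coefficient of the single-edge chain-rule minor is `−1` at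
`n = 7`, pairs `(0,1),(0,4),(0,5),(0,6),(1,2),(1,5),(2,3),(2,5),(3,4)`, `x = 6, u = 4, v = 3, o = 2, Y = {1}`, profile
`k = (1,1,1,2,2,1,2,1,2)` (and `0` on every other pair): the signed count over the `3⁹` profile-compatible triples of
configurations of `det[1{S_r ↮ T_c in copy c}]` is `183 + 360 − 343 − 201 = −1 < 0` (kernel-evaluated, `BernCex.sum_tm`;
reindexing `BernCex.Φ / Ψ`; entries by `FK.RCEval.reachB_iff` and the kernel-checked table `BernCex.table_spec`).  The chain rule
`Consts.SingleEdgeChainRule` itself is not refuted; only the coefficientwise conjecture and the route through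
`Consts.singleEdgeChainRule_of_chainRuleBernstein` fall.  Witness found by the exhaustive exact census of the constants cell
(ttrl3 relay 97, 2026-08-21). [cite: VandenbergHaggstromKahn2005, Thm. 1.1 (pp. 3–5)] -/
theorem not_chainRuleBernstein : ¬ ChainRuleBernstein := by
  intro h
  have h1 := h 7 6 4 3 2 ({1} : Set (Fin 7)) BernCex.kW
  rw [BernCex.fibre_sum_det, BernCex.sum_tm] at h1
  norm_num at h1

end Consts

end Summit.CriticalPhenomena.PercolationContinuityZ3.Theorems
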